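import Mathlib

/-!
# `Balaban1983to89.B16Eq14` — (1.4) and (1.5) of T. Bałaban, *Large field renormalization. II. Localization,
exponentiation, and bounds for the 𝐑 operation*, Commun. Math. Phys. **122**, 355–392 (1989) [Balaban1989LargeFieldII],
p. 357: the criticality condition of the background `U₀` off `Λ`, its consequence `J₀ = 0` on `Λ`, and the rewriting
(1.5) of the linear term of (1.2) — TYPED over real inner-product spaces, the two consequences PROVED

statement-level skeleton of published theorems with citation tags; proofs where landed; nothing here is a claim about
the Yang–Mills mass gap

PDF held: `paper:balaban1989-cmp122-large-field-ii` (journal page = PDF page + 354); [15] = [Balaban1985Variational].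
The quotations below were READ AS AN IMAGE by this seat on the x4 render
`run/shared/lean/pub/pub-balaban/b2b-balaban-ref1/pages/1989-cmp122-large-field-II/…-p003-x4.png` (p. 357).

CITATION HEADER / WHAT IS REPRODUCED (mega-formalization `lit-balaban`, reader/typer r13 gen 3; HOME
`run/shared/lean/pub/lit-balaban/`, rows `lit-balaban-r13/ROWS-B16.md`): SKELETON rows **B16.Eq1.4** and **B16.Eq1.5**
(both `absent` at SKELETON v3.12).  p. 357 [PDF 3], verbatim: *"To consider the second term in the exponential we make
the following remark about the configuration U₀. It is a minimum of the functional U → A(U), for U : U defined and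
regular on Z, M_{𝐁_k}(U) = M_{𝐁_k(Z)}(Q_k^{s*}V_k) on Z∖Λ. (1.3)  By the results of Sect. G [15] we have the condition
⟨δA, J₀⟩ = 0 for all δA : Q_{𝐁_k(Z)}δA = 0 on Z∖Λ, (1.4) where J₀ is the current defined by U₀, and Q_{𝐁_k(Z)} is the
linear averaging operation defined by U₀ and 𝐁_k(Z). In particular, the above condition is satisfied for all δA with
supp δA ⊂ Λ, therefore J₀ = 0 on Λ. The functions δA = H_{1,k}B′ satisfy also the condition in (5.4), therefore
⟨H_{1,k}B′, J₀⟩ = ⟨DH_{1,k}B′, Im ∂U₀⟩ = 0, and we have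
−(1/g_k)⟨DH_{1,k}B′, ζη⁻²Im ∂U₀⟩ = (1/g_k)⟨DH_{1,k}B′, (1 − ζ₀)η⁻²Im ∂U₀⟩. (1.5)"* ("(5.4)" = (1.4), cell slip
D-b02.1; the `ζ` on the left of (1.5) is the `ζ₀` of (1.2), whose second term is `−(1/g_k)⟨DH_{1,k}B′, ζ₀η⁻²Im ∂U₀⟩`.)

CARRIERS (ref-1 F6; no new structure, no `def`).  `F` = the real inner-product space of (𝔤-valued) vector fields `δA`
on `Z` (currents `J₀` live there too; `⟨·,·⟩` of the display); `D` = the space of fields on the determining set `𝐁_k(Z)`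
and `Q : F →ₗ D` = the linear averaging `Q_{𝐁_k(Z)}`; `R : D →ₗ D'` = restriction of a datum to (the members of `𝐁_k(Z)`
in) `Z∖Λ`, so *"Q_{𝐁_k(Z)}δA = 0 on Z∖Λ"* reads `R(QδA) = 0`; `PΛ : F →ₗ F` = the orthogonal projection onto the fields
supported in `Λ` (`hP2`, `hPsa`), so *"supp δA ⊂ Λ"* reads `PΛδA = δA` and *"J₀ = 0 on Λ"* reads `PΛJ₀ = 0`; `E` = the
space of fields `B′` and `H : E →ₗ F` = `H_{1,k}`; `P` = the space of plaquette fields with `Dop : F →ₗ P` = `D`, `X` =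
`η⁻²Im ∂U₀`, `Mζ : P →ₗ P` = multiplication by `ζ₀`.  The located facts the print uses are hypotheses quoted at their
binders: `hloc` (*"the above condition is satisfied for all δA with supp δA ⊂ Λ"* — fields supported in `Λ` have zero
averages over the members in `Z∖Λ`), `hH` (*"The functions δA = H_{1,k}B′ satisfy also the condition in (1.4)"*).  Every
declaration is a theorem proved from its displayed hypotheses; nothing printed is asserted as a fact.
-/

namespace Literature.MathematicalPhysics.QuantumFieldTheory.Balaban1983to89.B16Eq14

open scoped RealInnerProductSpace

variable {F D D' E : Type*} [NormedAddCommGroup F] [InnerProductSpace ℝ F] [AddCommGroup D] [Module ℝ D]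
  [AddCommGroup D'] [Module ℝ D'] [AddCommGroup E] [Module ℝ E]

/-- **(1.4) ⇒ "J₀ = 0 on Λ"** p. 357 [PDF 3], verbatim: *"By the results of Sect. G [15] we have the condition
⟨δA, J₀⟩ = 0 for all δA : Q_{𝐁_k(Z)}δA = 0 on Z∖Λ, (1.4) … In particular, the above condition is satisfied for all δA
with supp δA ⊂ Λ, therefore J₀ = 0 on Λ."* — PROVED: with `PΛ` the orthogonal projection onto the fields supported in `Λ`
and the located fact `hloc` (such fields have zero averages on `Z∖Λ`), (1.4) gives `PΛJ₀ = 0`.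
[cite: Balaban1989LargeFieldII, (1.4) p.357] -/
theorem proj_J0_eq_zero_of_eq14 (Q : F →ₗ[ℝ] D) (R : D →ₗ[ℝ] D') {PΛ : F →ₗ[ℝ] F}
    (hP2 : ∀ x, PΛ (PΛ x) = PΛ x) (hPsa : ∀ x y, ⟪PΛ x, y⟫ = ⟪x, PΛ y⟫) {J₀ : F}
    (h14 : ∀ δA : F, R (Q δA) = 0 → ⟪δA, J₀⟫ = 0) (hloc : ∀ δA : F, PΛ δA = δA → R (Q δA) = 0) :
    PΛ J₀ = 0 := by
  refine ext_inner_left ℝ fun w => ?_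
  rw [inner_zero_right, ← hPsa]
  exact h14 (PΛ w) (hloc (PΛ w) (hP2 w))

/-- **(1.4) for `δA = H_{1,k}B′`** p. 357, verbatim: *"The functions δA = H_{1,k}B′ satisfy also the condition in (5.4),
therefore ⟨H_{1,k}B′, J₀⟩ = ⟨DH_{1,k}B′, Im ∂U₀⟩ = 0"* — PROVED from (1.4) and the located fact `hH` that the fields
`H_{1,k}B′` satisfy its constraint. [cite: Balaban1989LargeFieldII, (1.4) p.357] -/
theorem inner_H_J0_eq_zero_of_eq14 (Q : F →ₗ[ℝ] D) (R : D →ₗ[ℝ] D') (H : E →ₗ[ℝ] F) {J₀ : F}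
    (h14 : ∀ δA : F, R (Q δA) = 0 → ⟪δA, J₀⟫ = 0) (hH : ∀ B : E, R (Q (H B)) = 0) (B : E) :
    ⟪H B, J₀⟫ = 0 :=
  h14 (H B) (hH B)

/-- **(1.5)** p. 357 [PDF 3], verbatim: *"therefore ⟨H_{1,k}B′, J₀⟩ = ⟨DH_{1,k}B′, Im ∂U₀⟩ = 0, and we have
−(1/g_k)⟨DH_{1,k}B′, ζη⁻²Im ∂U₀⟩ = (1/g_k)⟨DH_{1,k}B′, (1 − ζ₀)η⁻²Im ∂U₀⟩. (1.5)"* — PROVED: for `a = DH_{1,k}B′`,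
`X = η⁻²Im ∂U₀` with `⟨a, X⟩ = 0` and `Mζ` = multiplication by the cut-off `ζ₀`,
`−g_k⁻¹⟨a, ζ₀X⟩ = g_k⁻¹⟨a, (1 − ζ₀)X⟩`. [cite: Balaban1989LargeFieldII, (1.5) p.357] -/
theorem eq15 {V : Type*} [NormedAddCommGroup V] [InnerProductSpace ℝ V] (Mζ : V →ₗ[ℝ] V) (gk : ℝ) {a X : V}
    (hJ : ⟪a, X⟫ = 0) : -(gk⁻¹ * ⟪a, Mζ X⟫) = gk⁻¹ * ⟪a, X - Mζ X⟫ := by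
  rw [inner_sub_right, hJ, zero_sub, mul_neg]

/-- (1.5) with the pairing written through `D`: if `⟨DH_{1,k}B′, η⁻²Im ∂U₀⟩ = 0` (the printed
`⟨H_{1,k}B′, J₀⟩ = ⟨DH_{1,k}B′, Im ∂U₀⟩ = 0`), then the second term of (1.2) equals its `(1 − ζ₀)`-localized form:
`−g_k⁻¹⟨DH_{1,k}B′, ζ₀η⁻²Im ∂U₀⟩ = g_k⁻¹⟨DH_{1,k}B′, (1 − ζ₀)η⁻²Im ∂U₀⟩`. [cite: Balaban1989LargeFieldII, (1.5) p.357] -/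
theorem eq15_D {V : Type*} [NormedAddCommGroup V] [InnerProductSpace ℝ V] (DH : E →ₗ[ℝ] V) (Mζ : V →ₗ[ℝ] V) (gk : ℝ) (X : V) {B : E}
    (hJ : ⟪DH B, X⟫ = 0) : -(gk⁻¹ * ⟪DH B, Mζ X⟫) = gk⁻¹ * ⟪DH B, X - Mζ X⟫ :=
  eq15 Mζ gk hJ

end Literature.MathematicalPhysics.QuantumFieldTheory.Balaban1983to89.B16Eq14
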